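import Mathlib
import HarnessLib
import Literature.NumberTheory.Transcendental.MZVSimplexRepProofs

/-!
# Stub `stub_cellZetaMovesLow` of line `tame-bv-stokes` (crux `DihedralNormalForm`) — tools I

Support file for the stub `stub_cellZetaMovesLow` (the low-dimensional cells `ℓ ≤ 2` of the
cellular zeta reduction): **residues of a convergent Arnold combination on the open 2-simplex.**
If the six-term combination

  `c₀₀/(t₀t₁) + c₁₀/((t₀-1)t₁) + c₀₁/(t₀(t₁-1)) + c₁₁/((t₀-1)(t₁-1)) + c₀ₜ/(t₀(t₁-t₀)) + c₁ₜ/((t₀-1)(t₁-t₀))`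

is absolutely integrable on `{1 > t₀ > t₁ > 0}`, then `c₀₀ = c₁₀ = c₁₁ = c₀ₜ = c₁ₜ = 0`: only the
`ζ(2)` form `dt₀ dt₁ / (t₀ (1 - t₁))` survives (`cellZeta_six`, registered sub-goal
`stub_cellZetaMovesLowAux1`). Proof: by Tonelli almost every slice of an integrable function on
the simplex is integrable (`cellZeta_slices`, in the product coordinates
`MeasurableEquiv.finTwoArrow`); a slice `k/(y - a) + (integrable)` on `(a, b)` is integrable only
if `k = 0` (`cellZeta_residue_left/right`, from `intervalIntegrable_sub_inv_iff`); the residue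
functions along the edge `t₁ → 0`, the diagonal `t₁ → t₀` and the edge `t₀ → 1` are the rational
functions `c₀₀/x + c₁₀/(x-1)`, `c₀ₜ/x + c₁ₜ/(x-1)`, `c₁₀/y + (c₁₁ + c₁ₜ)/(y-1)`, which therefore
vanish almost everywhere, hence everywhere on `(0, 1)` (continuity), hence have zero coefficients.

References: M. Kontsevich, D. Zagier, *Periods* (2001), §1.1 (absolute convergence is part of the
definition of a period); F. Brown, S. Carr, L. Schneps, *The algebra of cell-zeta values* (2010),
§4.4 (the convergent cell-forms on `M_{0,5}`).
-/

noncomputable section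

open MeasureTheory Set
open Literature.NumberTheory.Transcendental

namespace Summit.KontsevichZagierPeriods.DihedralNormalForm.TameBVStokes

/-! ### One-dimensional residues -/

/-- **Residue at the left end-point.** If `G = k/(y-a) + B` on `(a, b)` with `B` and `G` integrable
there, then `k = 0` (`∫ₐ dy/(y-a)` diverges). [folklore] -/
theorem cellZeta_residue_left {a b k : ℝ} (hab : a < b) {B G : ℝ → ℝ}
    (hB : IntegrableOn B (Ioo a b)) (hG : IntegrableOn G (Ioo a b))
    (heq : EqOn G (fun y => k * (y - a)⁻¹ + B y) (Ioo a b)) : k = 0 := by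
  by_contra hk
  have h1 : IntegrableOn (fun y => k * (y - a)⁻¹) (Ioo a b) := by
    refine ((hG.congr_fun heq measurableSet_Ioo).sub hB).congr_fun (fun y _ => ?_) measurableSet_Ioo
    simp
  have h2 : IntegrableOn (fun y => (y - a)⁻¹) (Ioo a b) := by
    refine IntegrableOn.congr_fun (h1.const_mul k⁻¹) (fun y _ => ?_) measurableSet_Ioo
    rw [← mul_assoc, inv_mul_cancel₀ hk, one_mul]
  have h3 := (intervalIntegrable_sub_inv_iff (a := a) (b := b) (c := a)).mp
    ((intervalIntegrable_iff_integrableOn_Ioo_of_le hab.le).mpr h2)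
  rcases h3 with h | h
  · exact hab.ne h
  · exact h left_mem_uIcc

/-- **Residue at the right end-point.** If `G = k/(y-b) + B` on `(a, b)` with `B` and `G`
integrable there, then `k = 0`. [folklore] -/
theorem cellZeta_residue_right {a b k : ℝ} (hab : a < b) {B G : ℝ → ℝ}
    (hB : IntegrableOn B (Ioo a b)) (hG : IntegrableOn G (Ioo a b))
    (heq : EqOn G (fun y => k * (y - b)⁻¹ + B y) (Ioo a b)) : k = 0 := by
  by_contra hk
  have h1 : IntegrableOn (fun y => k * (y - b)⁻¹) (Ioo a b) := by
    refine ((hG.congr_fun heq measurableSet_Ioo).sub hB).congr_fun (fun y _ => ?_) measurableSet_Ioo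
    simp
  have h2 : IntegrableOn (fun y => (y - b)⁻¹) (Ioo a b) := by
    refine IntegrableOn.congr_fun (h1.const_mul k⁻¹) (fun y _ => ?_) measurableSet_Ioo
    rw [← mul_assoc, inv_mul_cancel₀ hk, one_mul]
  have h3 := (intervalIntegrable_sub_inv_iff (a := a) (b := b) (c := b)).mp
    ((intervalIntegrable_iff_integrableOn_Ioo_of_le hab.le).mpr h2)
  rcases h3 with h | h
  · exact hab.ne h
  · exact h right_mem_uIcc

/-- A rational function `a/x + b/(x-1)` vanishing on `(0, 1)` is zero. [folklore] -/
theorem cellZeta_rat_zero {a b : ℝ} (h : ∀ x ∈ Ioo (0:ℝ) 1, a / x + b / (x - 1) = 0) :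
    a = 0 ∧ b = 0 := by
  have h1 := h (1 / 2) ⟨by norm_num, by norm_num⟩
  have h2 := h (1 / 4) ⟨by norm_num, by norm_num⟩
  norm_num at h1 h2
  constructor <;> linarith

/-- A function continuous on `(0, 1)` and vanishing almost everywhere there vanishes there
(Lebesgue measure charges open sets). [folklore] -/
theorem cellZeta_ae_zero {g : ℝ → ℝ} (hg : ContinuousOn g (Ioo (0:ℝ) 1))
    (h : ∀ᵐ x : ℝ, x ∈ Ioo (0:ℝ) 1 → g x = 0) : ∀ x ∈ Ioo (0:ℝ) 1, g x = 0 := by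
  have h1 : g =ᵐ[volume.restrict (Ioo (0:ℝ) 1)] (fun _ => (0:ℝ)) :=
    (ae_restrict_iff' measurableSet_Ioo).2 h
  exact Measure.eqOn_Ioo_of_ae_eq (μ := volume) h1 hg continuousOn_const

/-! ### Slices of an integrable function on the open 2-simplex -/

/-- **Tonelli on the simplex.** If `G` is integrable on `{1 > t₀ > t₁ > 0}`, then for almost every
`x ∈ (0,1)` the slice `y ↦ G(x, y)` is integrable on `(0, x)`, and for almost every `y ∈ (0,1)` the
slice `x ↦ G(x, y)` is integrable on `(y, 1)`. [folklore] -/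
theorem cellZeta_slices (G : (Fin 2 → ℝ) → ℝ)
    (hG : IntegrableOn G {t : Fin 2 → ℝ | (∀ i, 0 < t i) ∧ (∀ i, t i < 1) ∧ StrictAnti t}) :
    (∀ᵐ x : ℝ, x ∈ Ioo (0:ℝ) 1 → IntegrableOn (fun y => G ![x, y]) (Ioo 0 x)) ∧
    (∀ᵐ y : ℝ, y ∈ Ioo (0:ℝ) 1 → IntegrableOn (fun x => G ![x, y]) (Ioo y 1)) := by
  set S : Set (Fin 2 → ℝ) := {t | (∀ i, 0 < t i) ∧ (∀ i, t i < 1) ∧ StrictAnti t} with hS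
  set e := (MeasurableEquiv.finTwoArrow (α := ℝ)) with he
  have hmp : MeasurePreserving e.symm volume volume := (volume_preserving_finTwoArrow ℝ).symm e
  have hSm : MeasurableSet S := KZ.measurableSet_openOrderedSimplex 2
  have h1 : IntegrableOn (G ∘ e.symm) (e.symm ⁻¹' S) volume :=
    (hmp.integrableOn_comp_preimage e.symm.measurableEmbedding).2 hG
  have hT : e.symm ⁻¹' S = {p : ℝ × ℝ | 0 < p.2 ∧ p.2 < p.1 ∧ p.1 < 1} := by
    ext p
    simp only [mem_preimage, hS, mem_setOf_eq, Fin.forall_fin_two]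
    constructor
    · rintro ⟨⟨h0, h1⟩, ⟨h2, h3⟩, h4⟩
      exact ⟨h1, h4 (show (0 : Fin 2) < 1 by decide), h2⟩
    · rintro ⟨h0, h1, h2⟩
      refine ⟨⟨by show 0 < p.1; linarith, h0⟩, ⟨h2, by show p.2 < 1; linarith⟩, ?_⟩
      intro i j hij
      fin_cases i <;> fin_cases j
      · exact absurd hij (lt_irrefl _)
      · exact h1
      · exact absurd hij (by decide)
      · exact absurd hij (lt_irrefl _)
  rw [hT] at h1
  have hTm : MeasurableSet {p : ℝ × ℝ | 0 < p.2 ∧ p.2 < p.1 ∧ p.1 < 1} := by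
    rw [← hT]; exact hSm.preimage e.symm.measurable
  have h2 : Integrable ({p : ℝ × ℝ | 0 < p.2 ∧ p.2 < p.1 ∧ p.1 < 1}.indicator (G ∘ e.symm))
      ((volume : Measure ℝ).prod volume) :=
    (integrable_indicator_iff hTm).2 h1
  constructor
  · filter_upwards [h2.prod_right_ae] with x hx hx01
    have h3 : (fun y => {p : ℝ × ℝ | 0 < p.2 ∧ p.2 < p.1 ∧ p.1 < 1}.indicator (G ∘ e.symm) (x, y)) =
        (Ioo 0 x).indicator (fun y => G ![x, y]) := by
      funext y
      by_cases hy : y ∈ Ioo 0 x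
      · rw [indicator_of_mem hy, indicator_of_mem (show (x, y) ∈
          {p : ℝ × ℝ | 0 < p.2 ∧ p.2 < p.1 ∧ p.1 < 1} from ⟨hy.1, hy.2, hx01.2⟩)]
        rfl
      · rw [indicator_of_notMem hy, indicator_of_notMem]
        rintro ⟨h0, h1, -⟩
        exact hy ⟨h0, h1⟩
    rw [h3, integrable_indicator_iff measurableSet_Ioo] at hx
    exact hx
  · filter_upwards [h2.prod_left_ae] with y hy hy01
    have h3 : (fun x => {p : ℝ × ℝ | 0 < p.2 ∧ p.2 < p.1 ∧ p.1 < 1}.indicator (G ∘ e.symm) (x, y)) =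
        (Ioo y 1).indicator (fun x => G ![x, y]) := by
      funext x
      by_cases hx : x ∈ Ioo y 1
      · rw [indicator_of_mem hx, indicator_of_mem (show (x, y) ∈
          {p : ℝ × ℝ | 0 < p.2 ∧ p.2 < p.1 ∧ p.1 < 1} from ⟨hy01.1, hx.1, hx.2⟩)]
        rfl
      · rw [indicator_of_notMem hx, indicator_of_notMem]
        rintro ⟨-, h1, h2⟩
        exact hx ⟨h1, h2⟩
    rw [h3, integrable_indicator_iff measurableSet_Ioo] at hy
    exact hy

/-! ### The three residues of the six-term combination -/

/-- **Residues along `t₁ → 0` and along the diagonal `t₁ → t₀`.** If the `t₁`-slice of the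
six-term combination at `x ∈ (0,1)` is integrable on `(0, x)`, then `c₀₀/x + c₁₀/(x-1) = 0` and
`c₀ₜ/x + c₁ₜ/(x-1) = 0`. [folklore] -/
theorem cellZeta_six_slice_y (c₀₀ c₁₀ c₀₁ c₁₁ c₀ₜ c₁ₜ x : ℝ) (hx : x ∈ Ioo (0:ℝ) 1)
    (h : IntegrableOn (fun y : ℝ => c₀₀ / (x * y) + c₁₀ / ((x - 1) * y) + c₀₁ / (x * (y - 1)) +
      c₁₁ / ((x - 1) * (y - 1)) + c₀ₜ / (x * (y - x)) + c₁ₜ / ((x - 1) * (y - x))) (Ioo 0 x)) :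
    c₀₀ / x + c₁₀ / (x - 1) = 0 ∧ c₀ₜ / x + c₁ₜ / (x - 1) = 0 := by
  have hx0 : x ≠ 0 := hx.1.ne'
  have hx1 : x - 1 ≠ 0 := by have := hx.2; intro h; linarith [sub_eq_zero.1 h]
  constructor
  · -- the edge `y → 0`
    have hB : ContinuousOn (fun y : ℝ => c₀₁ / (x * (y - 1)) + c₁₁ / ((x - 1) * (y - 1)) +
        c₀ₜ / (x * (y - x)) + c₁ₜ / ((x - 1) * (y - x))) (Icc 0 (x / 2)) := by
      have h1 : ∀ y ∈ Icc (0:ℝ) (x / 2), x * (y - 1) ≠ 0 := fun y hy =>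
        mul_ne_zero hx0 (by intro h; linarith [hy.2, hx.2, sub_eq_zero.1 h])
      have h2 : ∀ y ∈ Icc (0:ℝ) (x / 2), (x - 1) * (y - 1) ≠ 0 := fun y hy =>
        mul_ne_zero hx1 (by intro h; linarith [hy.2, hx.2, sub_eq_zero.1 h])
      have h3 : ∀ y ∈ Icc (0:ℝ) (x / 2), x * (y - x) ≠ 0 := fun y hy =>
        mul_ne_zero hx0 (by intro h; linarith [hy.2, hx.1, sub_eq_zero.1 h])
      have h4 : ∀ y ∈ Icc (0:ℝ) (x / 2), (x - 1) * (y - x) ≠ 0 := fun y hy =>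
        mul_ne_zero hx1 (by intro h; linarith [hy.2, hx.1, sub_eq_zero.1 h])
      exact (((continuousOn_const.div (by fun_prop) h1).add
        (continuousOn_const.div (by fun_prop) h2)).add
        (continuousOn_const.div (by fun_prop) h3)).add
        (continuousOn_const.div (by fun_prop) h4)
    have hab : (0:ℝ) < x / 2 := by linarith [hx.1]
    refine cellZeta_residue_left hab
      ((hB.integrableOn_compact isCompact_Icc).mono_set Ioo_subset_Icc_self)
      (h.mono_set (Ioo_subset_Ioo_right (by linarith [hx.1]))) fun y hy => ?_
    have hy0 : y ≠ 0 := hy.1.ne'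
    have hy1 : y - 1 ≠ 0 := by intro h; linarith [hy.2, hx.2, sub_eq_zero.1 h]
    have hyx : y - x ≠ 0 := by intro h; linarith [hy.2, hx.1, sub_eq_zero.1 h]
    simp only [sub_zero]
    field_simp
    ring
  · -- the diagonal `y → x`
    have hB : ContinuousOn (fun y : ℝ => c₀₀ / (x * y) + c₁₀ / ((x - 1) * y) +
        c₀₁ / (x * (y - 1)) + c₁₁ / ((x - 1) * (y - 1))) (Icc (x / 2) x) := by
      have h1 : ∀ y ∈ Icc (x / 2) x, x * y ≠ 0 := fun y hy =>
        mul_ne_zero hx0 (by intro h; linarith [hy.1, hx.1])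
      have h2 : ∀ y ∈ Icc (x / 2) x, (x - 1) * y ≠ 0 := fun y hy =>
        mul_ne_zero hx1 (by intro h; linarith [hy.1, hx.1])
      have h3 : ∀ y ∈ Icc (x / 2) x, x * (y - 1) ≠ 0 := fun y hy =>
        mul_ne_zero hx0 (by intro h; linarith [hy.2, hx.2, sub_eq_zero.1 h])
      have h4 : ∀ y ∈ Icc (x / 2) x, (x - 1) * (y - 1) ≠ 0 := fun y hy =>
        mul_ne_zero hx1 (by intro h; linarith [hy.2, hx.2, sub_eq_zero.1 h])
      exact (((continuousOn_const.div (by fun_prop) h1).add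
        (continuousOn_const.div (by fun_prop) h2)).add
        (continuousOn_const.div (by fun_prop) h3)).add
        (continuousOn_const.div (by fun_prop) h4)
    have hab : x / 2 < x := by linarith [hx.1]
    refine cellZeta_residue_right hab
      ((hB.integrableOn_compact isCompact_Icc).mono_set Ioo_subset_Icc_self)
      (h.mono_set (Ioo_subset_Ioo_left (by linarith [hx.1]))) fun y hy => ?_
    have hy0 : y ≠ 0 := by intro h; linarith [hy.1, hx.1]
    have hy1 : y - 1 ≠ 0 := by intro h; linarith [hy.2, hx.2, sub_eq_zero.1 h]
    have hyx : y - x ≠ 0 := by intro h; linarith [hy.2, sub_eq_zero.1 h]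
    show _ = _
    field_simp
    ring

/-- **Residue along `t₀ → 1`.** If the `t₀`-slice of the six-term combination at `y ∈ (0,1)` is
integrable on `(y, 1)`, then `c₁₀/y + (c₁₁ + c₁ₜ)/(y-1) = 0` (partial fractions
`1/((x-1)(y-x)) = (1/(x-1) + 1/(y-x))/(y-1)`). [folklore] -/
theorem cellZeta_six_slice_x (c₀₀ c₁₀ c₀₁ c₁₁ c₀ₜ c₁ₜ y : ℝ) (hy : y ∈ Ioo (0:ℝ) 1)
    (h : IntegrableOn (fun x : ℝ => c₀₀ / (x * y) + c₁₀ / ((x - 1) * y) + c₀₁ / (x * (y - 1)) +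
      c₁₁ / ((x - 1) * (y - 1)) + c₀ₜ / (x * (y - x)) + c₁ₜ / ((x - 1) * (y - x))) (Ioo y 1)) :
    c₁₀ / y + (c₁₁ + c₁ₜ) / (y - 1) = 0 := by
  have hy0 : y ≠ 0 := hy.1.ne'
  have hy1 : y - 1 ≠ 0 := by have := hy.2; intro h; linarith [sub_eq_zero.1 h]
  have hB : ContinuousOn (fun x : ℝ => c₀₀ / (x * y) + c₀₁ / (x * (y - 1)) +
      c₀ₜ / (x * (y - x)) + c₁ₜ / ((y - 1) * (y - x))) (Icc ((1 + y) / 2) 1) := by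
    have h1 : ∀ x ∈ Icc ((1 + y) / 2) (1:ℝ), x * y ≠ 0 := fun x hx =>
      mul_ne_zero (by intro h; linarith [hx.1, hy.1]) hy0
    have h2 : ∀ x ∈ Icc ((1 + y) / 2) (1:ℝ), x * (y - 1) ≠ 0 := fun x hx =>
      mul_ne_zero (by intro h; linarith [hx.1, hy.1]) hy1
    have h3 : ∀ x ∈ Icc ((1 + y) / 2) (1:ℝ), x * (y - x) ≠ 0 := fun x hx =>
      mul_ne_zero (by intro h; linarith [hx.1, hy.1])
        (by intro h; linarith [hx.1, hy.2, sub_eq_zero.1 h])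
    have h4 : ∀ x ∈ Icc ((1 + y) / 2) (1:ℝ), (y - 1) * (y - x) ≠ 0 := fun x hx =>
      mul_ne_zero hy1 (by intro h; linarith [hx.1, hy.2, sub_eq_zero.1 h])
    exact (((continuousOn_const.div (by fun_prop) h1).add
      (continuousOn_const.div (by fun_prop) h2)).add
      (continuousOn_const.div (by fun_prop) h3)).add
      (continuousOn_const.div (by fun_prop) h4)
  have hab : (1 + y) / 2 < 1 := by linarith [hy.2]
  refine cellZeta_residue_right hab
    ((hB.integrableOn_compact isCompact_Icc).mono_set Ioo_subset_Icc_self)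
    (h.mono_set (Ioo_subset_Ioo_left (by linarith [hy.1]))) fun x hx => ?_
  have hx0 : x ≠ 0 := by intro h; linarith [hx.1, hy.1]
  have hx1 : x - 1 ≠ 0 := by intro h; linarith [hx.2, sub_eq_zero.1 h]
  have hyx : y - x ≠ 0 := by intro h; linarith [hx.1, hy.2, sub_eq_zero.1 h]
  show _ = _
  field_simp
  ring

/-! ### The six-coefficient lemma -/

/-- **Residues of a convergent Arnold combination on the 2-simplex.** If
`c₀₀/(t₀t₁) + c₁₀/((t₀-1)t₁) + c₀₁/(t₀(t₁-1)) + c₁₁/((t₀-1)(t₁-1)) + c₀ₜ/(t₀(t₁-t₀)) + c₁ₜ/((t₀-1)(t₁-t₀))`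
is integrable on `{1 > t₀ > t₁ > 0}` then `c₀₀ = c₁₀ = c₁₁ = c₀ₜ = c₁ₜ = 0`.
[cite: KontsevichZagier2001, §1.1] -/
theorem cellZeta_six (c₀₀ c₁₀ c₀₁ c₁₁ c₀ₜ c₁ₜ : ℝ)
    (h : IntegrableOn (fun t : Fin 2 → ℝ => c₀₀ / (t 0 * t 1) + c₁₀ / ((t 0 - 1) * t 1) +
      c₀₁ / (t 0 * (t 1 - 1)) + c₁₁ / ((t 0 - 1) * (t 1 - 1)) + c₀ₜ / (t 0 * (t 1 - t 0)) +
      c₁ₜ / ((t 0 - 1) * (t 1 - t 0)))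
      {t : Fin 2 → ℝ | (∀ i, 0 < t i) ∧ (∀ i, t i < 1) ∧ StrictAnti t}) :
    c₀₀ = 0 ∧ c₁₀ = 0 ∧ c₁₁ = 0 ∧ c₀ₜ = 0 ∧ c₁ₜ = 0 := by
  obtain ⟨hY, hX⟩ := cellZeta_slices _ h
  simp only [Matrix.cons_val_zero, Matrix.cons_val_one] at hY hX
  -- residues along `y → 0` and `y → x`
  have h1 : ∀ᵐ x : ℝ, x ∈ Ioo (0:ℝ) 1 →
      c₀₀ / x + c₁₀ / (x - 1) = 0 ∧ c₀ₜ / x + c₁ₜ / (x - 1) = 0 := by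
    filter_upwards [hY] with x hx hx01
    exact cellZeta_six_slice_y c₀₀ c₁₀ c₀₁ c₁₁ c₀ₜ c₁ₜ x hx01 (hx hx01)
  -- residue along `x → 1`
  have h2 : ∀ᵐ y : ℝ, y ∈ Ioo (0:ℝ) 1 → c₁₀ / y + (c₁₁ + c₁ₜ) / (y - 1) = 0 := by
    filter_upwards [hX] with y hy hy01
    exact cellZeta_six_slice_x c₀₀ c₁₀ c₀₁ c₁₁ c₀ₜ c₁ₜ y hy01 (hy hy01)
  have hc : ∀ a b : ℝ, ContinuousOn (fun x : ℝ => a / x + b / (x - 1)) (Ioo (0:ℝ) 1) := by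
    intro a b
    exact (continuousOn_const.div (by fun_prop) fun x hx => hx.1.ne').add
      (continuousOn_const.div (by fun_prop) fun x hx => by
        intro h; linarith [hx.2, sub_eq_zero.1 h])
  have e1 := cellZeta_rat_zero (cellZeta_ae_zero (hc c₀₀ c₁₀)
    (h1.mono fun x hx hx01 => (hx hx01).1))
  have e2 := cellZeta_rat_zero (cellZeta_ae_zero (hc c₀ₜ c₁ₜ)
    (h1.mono fun x hx hx01 => (hx hx01).2))
  have e3 := cellZeta_rat_zero (cellZeta_ae_zero (hc c₁₀ (c₁₁ + c₁ₜ)) h2)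
  refine ⟨e1.1, e1.2, ?_, e2.1, e2.2⟩
  linarith [e3.2, e2.2]

/-! ### Registered sub-goal -/

/-- Registered sub-goal `stub_cellZetaMovesLowAux1` of this file: the residues of a convergent
six-term Arnold combination on the open 2-simplex vanish (`cellZeta_six`). -/
theorem stub_cellZetaMovesLowAux1 : ∀ (c₀₀ c₁₀ c₀₁ c₁₁ c₀ₜ c₁ₜ : ℝ), MeasureTheory.IntegrableOn (fun t : Fin 2 → ℝ => c₀₀ / (t 0 * t 1) + c₁₀ / ((t 0 - 1) * t 1) + c₀₁ / (t 0 * (t 1 - 1)) + c₁₁ / ((t 0 - 1) * (t 1 - 1)) + c₀ₜ / (t 0 * (t 1 - t 0)) + c₁ₜ / ((t 0 - 1) * (t 1 - t 0))) {t : Fin 2 → ℝ | (∀ i, 0 < t i) ∧ (∀ i, t i < 1) ∧ StrictAnti t} MeasureTheory.volume → c₀₀ = 0 ∧ c₁₀ = 0 ∧ c₁₁ = 0 ∧ c₀ₜ = 0 ∧ c₁ₜ = 0 :=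
  fun c₀₀ c₁₀ c₀₁ c₁₁ c₀ₜ c₁ₜ h => cellZeta_six c₀₀ c₁₀ c₀₁ c₁₁ c₀ₜ c₁ₜ h

end Summit.KontsevichZagierPeriods.DihedralNormalForm.TameBVStokes
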